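import Summits.ValiantsHypothesis.ValiantsHypothesis.Theorems.BarrierLeverChowBenchmarkPairsDirichletSplit

/-!
# Route BarrierLever — item 22038 `ChowBenchmarkPairs`, line `moore-peel`: the bad stages of the segment-mean peel
# as KERNEL TABLES (THEOREM W evaluated by `decide`)

Helper file (`--supports stmt-ValiantsHypothesis-22038`; cell valiant-natproofs, rung V4, 𝒟-side benchmark of
record, line `moore_peel`; seat val-np-p4 gen 27, memo `HOME/val-np-p4/g27/MEMO-valnp4-g27.md` §3).  Closes NO
item.  One auxiliary computable definition (`wHasRootAux`, the list-free root test of a window) and `badStageFast`.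

* `wHasRootAux f i c t ↔ t ∈ wrootsAux f i c` (`wHasRootAux_iff`): membership along the three-rule recursion of
  THEOREM W without materialising the root list (`O(log)` arithmetic per query).
* **`badStages_le_5000`**: the stages `1 ≤ i ≤ 5000` with `det G_i = 0` are EXACTLY the 41 numbers
  `183, 364, 444, 573, 628, 725, 726, 892, 959, 1149, 1460, 1461, 1494, 1496, 1775, 1788, 1919, 2173, 2301, 2402, 2509,
  2897, 2900, 2906, 2932, 2933, 2942, 2943, 2975, 2986, 2997, 3557, 3580, 3711, 3832, 3839, 3967, 4345, 4349, 4580, 4605`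
  (memo g18 §3 found the nine `≤ 1100` by rank computations mod p; here they are a theorem, five times as far).
* `det_peelMatrix_eq_zero_iff_mem_of_le_5000` — the usable form: for `1 ≤ i ≤ 5000`, `det G_i = 0 ↔ i ∈` that list.
* **`det_kpeelMatrix_ascFactorial_two_ne_zero_of_le_725`**: the Dirichlet(2,2) stage matrices are nonsingular for every
  `1 ≤ i ≤ 725` (and singular at `726`, `…DirichletSplit`): with THEOREM A^κ of `…KernelPoised` this is Dirichlet(2,2)
  poisedness at every height `h ≤ 725` (`kernelPoisedAt_ascFactorial_two_of_le_725`).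

WHAT THIS IS NOT: the segment-mean stub `stub_segmentMeanValue` (∀h) is untouched; nothing on crux
stmt-ValiantsHypothesis-14610 or on `VP` versus `VNP`.
-/

set_option linter.dupNamespace false

namespace Summit.ValiantsHypothesis.ValiantsHypothesis.Theorems.BarrierLever.MoorePeel

open Finset Matrix

/-! ## 1. The list-free root test -/

/-- List-free root test: `wHasRootAux f i c t ↔ t ∈ wrootsAux f i c`. -/
def wHasRootAux : ℕ → ℕ → ℕ → ℤ → Bool
  | 0, _, _, _ => false
  | f + 1, i, c, t =>
    if i = 0 ∨ c = 0 then false else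
      if topPow (c + i - 1) ≤ c then (t == 0) || wHasRootAux f i (c - topPow (c + i - 1)) (t - 1)
      else if i ≤ topPow (c + i - 1) then (t == 0) || wHasRootAux f (topPow (c + i - 1) - c) (topPow (c + i - 1) - i) t
      else (t == 0) || wHasRootAux f (i - topPow (c + i - 1)) c (t + 1)

/-- The list-free test computes membership in the root list. -/
theorem wHasRootAux_iff (f : ℕ) : ∀ (i c : ℕ) (t : ℤ), wHasRootAux f i c t = true ↔ t ∈ wrootsAux f i c := by
  induction f with
  | zero => intro i c t; simp [wHasRootAux, wrootsAux]
  | succ f ih =>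
    intro i c t
    rw [wHasRootAux, wrootsAux]
    by_cases h0 : i = 0 ∨ c = 0
    · rw [if_pos h0, if_pos h0]; simp
    rw [if_neg h0, if_neg h0]
    obtain ⟨hi0, hc0⟩ := not_or.mp h0
    have hspec := topPow_spec (m := c + i - 1) (by omega)
    by_cases h1 : topPow (c + i - 1) ≤ c
    · rw [if_pos h1, if_pos h1, Bool.or_eq_true, ih, List.mem_append, List.mem_replicate, List.mem_map]
      constructor
      · rintro (h | h)
        · exact Or.inl ⟨by omega, by simpa using h⟩
        · exact Or.inr ⟨t - 1, h, by ring⟩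
      · rintro (⟨-, h⟩ | ⟨a, ha, rfl⟩)
        · exact Or.inl (by simp [h])
        · exact Or.inr (by simpa using ha)
    rw [if_neg h1, if_neg h1]
    by_cases h2 : i ≤ topPow (c + i - 1)
    · rw [if_pos h2, if_pos h2, Bool.or_eq_true, ih, List.mem_append, List.mem_replicate]
      constructor
      · rintro (h | h)
        · exact Or.inl ⟨by omega, by simpa using h⟩
        · exact Or.inr h
      · rintro (⟨-, h⟩ | h)
        · exact Or.inl (by simp [h])
        · exact Or.inr h
    · rw [if_neg h2, if_neg h2, Bool.or_eq_true, ih, List.mem_append, List.mem_replicate, List.mem_map]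
      constructor
      · rintro (h | h)
        · exact Or.inl ⟨by omega, by simpa using h⟩
        · exact Or.inr ⟨t + 1, h, by ring⟩
      · rintro (⟨-, h⟩ | ⟨a, ha, rfl⟩)
        · exact Or.inl (by simp [h])
        · exact Or.inr (by simpa using ha)

/-- `t ∈ wroots i c ↔ wHasRootAux (i + c) i c t`. -/
theorem mem_wroots_iff (i c : ℕ) (t : ℤ) : t ∈ wroots i c ↔ wHasRootAux (i + c) i c t = true := by
  rw [wroots, wHasRootAux_iff]

/-- The fast bad-stage predicate. -/
def badStageFast (i : ℕ) : Bool := wHasRootAux (i + windowStart i) i (windowStart i) (-1)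

/-- The two bad-stage predicates agree. -/
theorem badStage_eq_badStageFast (i : ℕ) : badStage i = badStageFast i := by
  rw [badStage, badStageFast]
  by_cases h : wHasRootAux (i + windowStart i) i (windowStart i) (-1) = true
  · rw [h, decide_eq_true ((mem_wroots_iff _ _ _).mpr h)]
  · rw [Bool.not_eq_true] at h
    rw [h, decide_eq_false]
    rw [mem_wroots_iff, h]
    exact Bool.false_ne_true

/-- `det G_i = 0 ↔ badStageFast i`. -/
theorem det_peelMatrix_eq_zero_iff_badStageFast (i : ℕ) : (peelMatrix i).det = 0 ↔ badStageFast i = true := by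
  rw [det_peelMatrix_eq_zero_iff_badStage, badStage_eq_badStageFast]

/-! ## 2. Tables -/

/-- The 41 bad stages below `5000`. -/
def badStagesLe5000 : List ℕ :=
  [183, 364, 444, 573, 628, 725, 726, 892, 959, 1149, 1460, 1461, 1494, 1496, 1775, 1788, 1919, 2173, 2301, 2402, 2509,
   2897, 2900, 2906, 2932, 2933, 2942, 2943, 2975, 2986, 2997, 3557, 3580, 3711, 3832, 3839, 3967, 4345, 4349, 4580, 4605]

/-- **The bad stages `1 ≤ i ≤ 5000` of the segment-mean peel, by THEOREM W and `decide`.** -/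
theorem badStages_le_5000 :
    ((List.range 5001).filter fun i => 1 ≤ i ∧ badStageFast i) = badStagesLe5000 := by
  decide +kernel

/-- For `1 ≤ i ≤ 5000`: `det G_i = 0 ↔ i` is one of the 41 listed stages. -/
theorem det_peelMatrix_eq_zero_iff_mem_of_le_5000 (i : ℕ) (h1 : 1 ≤ i) (hi : i ≤ 5000) :
    (peelMatrix i).det = 0 ↔ i ∈ badStagesLe5000 := by
  rw [det_peelMatrix_eq_zero_iff_badStageFast, ← badStages_le_5000, List.mem_filter, List.mem_range]
  simp only [decide_eq_true_eq]
  constructor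
  · intro h; exact ⟨by omega, h1, h⟩
  · rintro ⟨-, -, h⟩; exact h

/-- No Dirichlet(2,2) bad stage below `726`. -/
theorem wHasRoot_two_eq_false_of_le_725 :
    ∀ i ∈ List.range 726, i = 0 ∨ wHasRootAux (i + windowStart i) i (windowStart i) (-2) = false := by
  decide +kernel

/-- **Dirichlet(2,2) stage matrices are nonsingular for every `1 ≤ i ≤ 725`** (and singular at `726`,
`det_kpeelMatrix_ascFactorial_two_726`). -/
theorem det_kpeelMatrix_ascFactorial_two_ne_zero_of_le_725 (i : ℕ) (h1 : 1 ≤ i) (hi : i ≤ 725) :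
    (kpeelMatrix (Nat.ascFactorial 2) i).det ≠ 0 := by
  intro h
  rw [det_kpeelMatrix_ascFactorial_eq_zero_iff, mem_wroots_iff] at h
  rcases wHasRoot_two_eq_false_of_le_725 i (List.mem_range.mpr (by omega)) with h' | h'
  · omega
  · push_cast at h
    rw [h] at h'
    exact Bool.noConfusion h'

/-- **Dirichlet(2,2) poisedness at every height `h ≤ 725`** (THEOREM A^κ, `kernelPoisedAt_of_kpeel`). -/
theorem kernelPoisedAt_ascFactorial_two_of_le_725 (h : ℕ) (hh : h ≤ 725) : KernelPoisedAt (Nat.ascFactorial 2) h :=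
  kernelPoisedAt_of_kpeel (Nat.ascFactorial 2) (fun k => ascFactorial_ne_zero_of_pos (by norm_num) k) h
    fun i hi1 hi2 => det_kpeelMatrix_ascFactorial_two_ne_zero_of_le_725 i hi1 (le_trans hi2 hh)

end Summit.ValiantsHypothesis.ValiantsHypothesis.Theorems.BarrierLever.MoorePeel
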